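import Summits.Parity.BatemanHorn.Theorems.SoloInformedTrapezoidProfileUniform
import Summits.Parity.BatemanHorn.Theorems.SoloInformedTrapezoidCancellation

/-!
# The trapezoid method under the scale profile: cancellation and Erdős's asymptotics

Informed soloist `solo-Parity-informed` (session 144), conjunct `BatemanHorn`, the `d ≥ 3` rung BELOW the parity
wall.  We sum the uniform block bound of `SoloInformedTrapezoidProfileUniform` over the `O(log X₁)` dyadic blocks
of the modulus range and compare with `ε·D·X₀ log X₀`.

Main results:
* `trapezoidCancellation_of_hooleyMeanProfile`: for `g` irreducible of degree `d ≥ 3`, `Δ > 0`,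
  `2 − 4/d < θ ≤ 1`, `1 − 2/d < η`: `HooleyMeanProfile g θ η → TrapezoidCancellation g Δ`;
* `erdosDivisorSumAsymptotic_of_hooleyMeanProfile`: moreover `→ ErdosDivisorSumAsymptotic g`, i.e.
  `∑_{n≤x} τ(g(n)) ~ d·A_g·x log x`; the cubic case `θ ∈ (2/3, 1]`, `η > 1/3`
  (`erdosDivisorSumAsymptotic_cubic_of_hooleyMeanProfile`).
Compared with `erdosDivisorSumAsymptotic_of_hooleyMeanLocal` the hypothesis allows an additive `o(E)`, so that NO
pointwise power saving in the equidistribution of the roots of `g` modulo `e` is asked (see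
`SoloInformedHooleyMeanProfile`).
-/

namespace Summit.Parity.BatemanHorn.Theorems

open Finset Polynomial
open Literature.NumberTheory.Sieve (polyRootCountMod)

/-! ### Dyadic summation against a general block bound -/

/-- From a block bound `Φ(E)` on the blocks `(E, E'] ⊆ (X₁, ∞)`, `E' ≤ 2E`, bounded by `B_max` for
`X₁ ≤ E ≤ U₀`, to the whole trapezoid form: `≤ (log₂⌊U₀⌋ + 1)·B_max` (`U₀ ≥ e^{Δ+B/2} X₁^{d/2}`, `U₀ ≥ X₁`).
[this work] -/
theorem norm_trapSum_le_dyadic_of_le (g : ℤ[X]) {Δ : ℝ} (hΔ : 0 < Δ) (hz : ∀ k : ℕ, g.eval (k : ℤ) ≠ 0)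
    {B : ℝ}
    (hB : ∀ n : ℕ, 1 ≤ n → |Real.log ((g.eval (n : ℤ)).natAbs : ℝ) - g.natDegree * Real.log n| ≤ B)
    {X₀ D : ℕ} {Φ : ℕ → ℝ} {Bmax U₀ : ℝ} (hBmax0 : 0 ≤ Bmax)
    (hK : ∀ E E' : ℕ, X₀ + D ≤ E → E ≤ E' → E' ≤ 2 * E →
      ‖∑ e ∈ Ioc E E', 1 / (e : ℂ) * ∑ h ∈ Ico 1 e, trapKernel g Δ X₀ D e h * hooleySum g e h‖ ≤ Φ E)
    (hΦ : ∀ E : ℕ, X₀ + D ≤ E → (E : ℝ) ≤ U₀ → Φ E ≤ Bmax) (h1 : 1 ≤ X₀ + D)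
    (hU₀ : Real.exp Δ * Real.exp (B / 2) * ((X₀ + D : ℕ) : ℝ) ^ ((g.natDegree : ℝ) / 2) ≤ U₀)
    (hXU : ((X₀ + D : ℕ) : ℝ) ≤ U₀) :
    ‖∑ e ∈ Ioc (X₀ + D) (trapOuter g (X₀ + D)),
        1 / (e : ℂ) * ∑ h ∈ Ico 1 e, trapKernel g Δ X₀ D e h * hooleySum g e h‖
      ≤ ((Nat.log 2 ⌊U₀⌋₊ : ℝ) + 1) * Bmax := by
  set X₁ : ℕ := X₀ + D with hX₁
  have hXr1 : (1 : ℝ) ≤ ((X₁ : ℕ) : ℝ) := by exact_mod_cast h1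
  have hU₀1 : 1 ≤ U₀ := hXr1.trans hXU
  set T : ℕ := ⌊U₀⌋₊ with hT
  have hXT : X₁ ≤ T := Nat.le_floor hXU
  set F : ℕ → ℂ := fun e => 1 / (e : ℂ) * ∑ h ∈ Ico 1 e, trapKernel g Δ X₀ D e h * hooleySum g e h
    with hF
  have hFzero : ∀ e : ℕ, T < e → F e = 0 := by
    intro e he
    have heU : U₀ < e := by
      have h1 := Nat.lt_floor_add_one U₀
      have h2 : (((⌊U₀⌋₊ + 1 : ℕ)) : ℝ) ≤ e := by exact_mod_cast he
      push_cast at h2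
      linarith
    have hK0 : ∀ h : ℤ, trapKernel g Δ X₀ D e h = 0 := fun h =>
      trapKernel_eq_zero_of_large g hΔ hz hB (lt_of_le_of_lt hU₀ heU) h
    simp only [hF, hK0, zero_mul, sum_const_zero, mul_zero]
  show ‖∑ e ∈ Ioc X₁ (trapOuter g X₁), F e‖ ≤ _
  rw [sum_Ioc_eq_sum_Ioc_min F hFzero]
  set t : ℕ := min (trapOuter g X₁) T with ht
  have htT : t ≤ T := min_le_right _ _
  have hblocks : ∀ E E' : ℕ, X₁ ≤ E → E ≤ E' → E' ≤ 2 * E → E' ≤ t → ‖∑ e ∈ Ioc E E', F e‖ ≤ Bmax := by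
    intro E E' hE hEE' hE'2 hE't
    refine (hK E E' hE hEE' hE'2).trans (hΦ E hE ?_)
    have h1 : (E : ℝ) ≤ T := by exact_mod_cast (hEE'.trans (hE't.trans htT))
    exact h1.trans (Nat.floor_le (by linarith))
  set J : ℕ := Nat.log 2 t + 1 with hJ
  have htJ : t ≤ 2 ^ J * X₁ := by
    have h1 := Nat.lt_pow_succ_log_self Nat.one_lt_two t
    calc t ≤ 2 ^ J := h1.le
      _ ≤ 2 ^ J * X₁ := Nat.le_mul_of_pos_right _ (by omega)
  have hZ := norm_sum_Ioc_le_dyadic F hBmax0 hblocks J X₁ t le_rfl htJ le_rfl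
  refine hZ.trans (mul_le_mul_of_nonneg_right ?_ hBmax0)
  rw [hJ]; push_cast
  have h1 : (Nat.log 2 t : ℝ) ≤ Nat.log 2 T := by exact_mod_cast Nat.log_mono_right htT
  linarith

/-- `1 + log X ≤ 3 log X₀` for `0 < X ≤ 2X₀`, `X₀ ≥ 3`. [folklore] -/
theorem one_add_log_le_three_mul_log {X X₀ : ℝ} (hX₀ : 3 ≤ X₀) (hX0 : 0 < X) (hX : X ≤ 2 * X₀) :
    1 + Real.log X ≤ 3 * Real.log X₀ := by
  have hlog3 : 1 < Real.log X₀ := by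
    rw [Real.lt_log_iff_exp_lt (by linarith)]
    have := Real.exp_one_lt_d9; linarith
  have h2 : Real.log X ≤ Real.log 2 + Real.log X₀ := by
    rw [← Real.log_mul (by norm_num) (by linarith)]
    exact Real.log_le_log hX0 hX
  have := Real.log_two_lt_d9
  linarith

/-! ### Cancellation from the scale profile -/

set_option maxHeartbeats 1600000 in
/-- **Trapezoid cancellation from the scale profile.**  For `g` irreducible of degree `d ≥ 3`, `Δ > 0`,
`2 − 4/d < θ ≤ 1` and `1 − 2/d < η`: `HooleyMeanProfile g θ η → TrapezoidCancellation g Δ`.  (Split exponent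
`σ = (min(η,1) + 1 − 2/d)/2`; the `o(E)` of the profile costs `ε·O_δ(D X₀ log X₀)`, the term `X₁DE^{σ−η}` costs
`o(D X₀ log X₀)`, the four old monomials are treated as in `trapezoidCancellation_of_hooleyMeanLocal`.)
[this work] -/
theorem trapezoidCancellation_of_hooleyMeanProfile {g : ℤ[X]} (hirr : Irreducible g) (hdeg : 3 ≤ g.natDegree)
    {Δ : ℝ} (hΔ : 0 < Δ) {θ η : ℝ} (hθ : 2 - 4 / (g.natDegree : ℝ) < θ) (hθ1 : θ ≤ 1)
    (hη : 1 - 2 / (g.natDegree : ℝ) < η) (hmp : HooleyMeanProfile g θ η) : TrapezoidCancellation g Δ := by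
  set d : ℕ := g.natDegree with hd
  have hd3 : (3 : ℝ) ≤ d := by exact_mod_cast hdeg
  have hdpos : (0 : ℝ) < d := by linarith
  -- WLOG `η ≤ 1`
  set η₁ : ℝ := min η 1 with hη₁
  have hη₁1 : η₁ ≤ 1 := min_le_right _ _
  have h2d : 0 < 2 / (d : ℝ) := by positivity
  have h2d1 : 2 / (d : ℝ) ≤ 1 := by rw [div_le_one hdpos]; linarith
  have h3d1 : 3 / (d : ℝ) ≤ 1 := by rw [div_le_one hdpos]; exact hd3
  have hη₁lo : 1 - 2 / (d : ℝ) < η₁ := lt_min hη (by linarith)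
  have hθ0 : 0 ≤ θ := by
    have : 4 / (d : ℝ) ≤ 2 := by rw [div_le_iff₀ hdpos]; linarith
    linarith
  -- the split exponent
  set σ : ℝ := (η₁ + 1 - 2 / d) / 2 with hσ
  have hσlt : σ < η₁ := by rw [hσ]; linarith
  have hσgt : 1 - 2 / (d : ℝ) < σ := by rw [hσ]; linarith
  have hσ0 : 0 ≤ σ := by linarith
  have hσθ : σ ≤ θ := by
    have e1 : (1 : ℝ) / d = (2 / d) / 2 := by ring
    have e2 : (4 : ℝ) / d - 1 / d = 3 / d := by ring
    have h1 : σ ≤ 1 - 1 / (d : ℝ) := by rw [hσ, e1]; linarith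
    linarith
  obtain ⟨C, hC0, hP⟩ := (hmp.mono_right (min_le_left η 1)).exists_nonneg
  obtain ⟨K, x₁, hK0, hK⟩ := exists_trapBlock_profile hirr (by omega) hΔ hC0 hθ1 hσ0 hσθ hP
  obtain ⟨B, hB⟩ := exists_abs_log_natAbs_eval_sub_le (g := g) (by omega)
  have hz : ∀ k : ℕ, g.eval (k : ℤ) ≠ 0 := eval_natCast_ne_zero_of_irreducible hirr (by omega)
  clear hP hmp
  -- the exponents `κ` (old monomials) and `η₁ − σ` (new monomial)
  set κ : ℝ := min (1 - (d : ℝ) / 2 * (1 - η₁)) (min (2 - (d : ℝ) / 2 * (2 - θ)) (η₁ + 2 / (d : ℝ) - 1))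
    with hκ
  have hκ0 : 0 < κ := trapKappa_pos hdpos hθ hη₁lo
  have hκle₁ : κ ≤ 1 - (d : ℝ) / 2 * (1 - η₁) := min_le_left _ _
  have hκle₂ : κ ≤ 2 - (d : ℝ) / 2 * (2 - θ) := (min_le_right _ _).trans (min_le_left _ _)
  have hκle₃ : κ ≤ η₁ + 2 / (d : ℝ) - 1 := (min_le_right _ _).trans (min_le_right _ _)
  have hκ₄ : 0 < η₁ - σ := by linarith
  have hdσ : (d : ℝ) / 2 * (1 - σ) ≤ 1 := by
    have h1 : 1 - σ ≤ 2 / (d : ℝ) := by linarith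
    have h2 := mul_le_mul_of_nonneg_left h1 (by positivity : (0 : ℝ) ≤ d / 2)
    rwa [show (d : ℝ) / 2 * (2 / d) = 1 by field_simp] at h2
  -- constants
  set KU : ℝ := Real.exp Δ * Real.exp (B / 2) with hKU
  have hKU1 : 1 ≤ KU := by
    have h1 : 1 ≤ Real.exp Δ := by have := Real.add_one_le_exp Δ; linarith
    have h2 : 1 ≤ Real.exp (B / 2) := by
      have hB0 : 0 ≤ B := by have h := hB 1 le_rfl; norm_num at h; exact (abs_nonneg _).trans h
      have := Real.add_one_le_exp (B / 2); linarith
    nlinarith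
  have hKU0 : 0 < KU := by linarith
  set cL : ℝ := 2 + Real.log KU + (d : ℝ) / 2 with hcL
  have hlogKU : 0 ≤ Real.log KU := Real.log_nonneg hKU1
  have hcL0 : 0 ≤ cL := by positivity
  set Kf : ℝ := K * KU ^ (2 : ℝ) * (2 * cL + 1) * (cL + 1) with hKf
  have hKf0 : 0 ≤ Kf := by positivity
  intro δ hδ hδ1 ε' hε'
  set ε₃ : ℝ := ε' / 3 with hε₃
  have hε₃0 : 0 < ε₃ := by positivity
  -- (old part) `(log x)² ≤ (c₁/4) x^κ` for `x ≥ a`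
  set c₁ : ℝ := ε₃ / (2 * Kf * (2 / δ + 1) + 1) with hc₁
  have hQ0 : 0 ≤ 2 * Kf * (2 / δ + 1) := by positivity
  have hc₁0 : 0 < c₁ := by positivity
  have hc₁le : 2 * Kf * (2 / δ + 1) * c₁ ≤ ε₃ := by
    rw [hc₁, mul_div_assoc', div_le_iff₀ (by positivity)]
    nlinarith
  obtain ⟨a, ha⟩ := Filter.eventually_atTop.mp
    ((isLittleO_log_rpow_rpow_atTop 2 hκ0).def (by positivity : 0 < c₁ / 4))
  -- (new monomial) `x^{−(η₁−σ)} ≤ c₂` for `x ≥ a₂`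
  set Q₂ : ℝ := 6 * K * (2 * cL + 1) with hQ₂
  have hQ₂0 : 0 ≤ Q₂ := by positivity
  set c₂ : ℝ := ε₃ / (Q₂ + 1) with hc₂
  have hc₂0 : 0 < c₂ := by positivity
  have hc₂le : Q₂ * c₂ ≤ ε₃ := by
    rw [hc₂, mul_div_assoc', div_le_iff₀ (by positivity)]
    nlinarith
  obtain ⟨a₂, ha₂⟩ := Filter.eventually_atTop.mp
    ((tendsto_rpow_neg_atTop hκ₄).eventually (Iic_mem_nhds hc₂0))
  -- (o(E) part) the profile's `ε`
  set Q₁ : ℝ := 3 * K * KU * (2 * cL + 1) * (4 + 4 / δ) with hQ₁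
  have hQ₁0 : 0 ≤ Q₁ := by positivity
  set ε : ℝ := ε₃ / (Q₁ + 1) with hεdef
  have hε0 : 0 < ε := by positivity
  have hεle : Q₁ * ε ≤ ε₃ := by
    rw [hεdef, mul_div_assoc', div_le_iff₀ (by positivity)]
    nlinarith
  obtain ⟨E₀, hE₀⟩ := hK ε hε0
  refine ⟨max x₁ (max 3 (max ⌈a⌉₊ (max ⌈a₂⌉₊ E₀))), fun X₀ D hx₀ hδD hDX => ?_⟩
  have hx₁X : x₁ ≤ X₀ := by omega
  have h3X : 3 ≤ X₀ := by omega
  have haX : ⌈a⌉₊ ≤ X₀ := by omega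
  have ha₂X : ⌈a₂⌉₊ ≤ X₀ := by omega
  have hE₀X : E₀ ≤ X₀ := by omega
  set Xr : ℝ := ((X₀ + D : ℕ) : ℝ) with hXr
  have hX₀r3 : (3 : ℝ) ≤ X₀ := by exact_mod_cast h3X
  have hX₀0 : (0 : ℝ) < X₀ := by linarith
  have hDr : (D : ℝ) ≤ X₀ := by exact_mod_cast hDX
  have hXrX : Xr = (X₀ : ℝ) + D := by rw [hXr]; push_cast; ring
  have hD0 : (0 : ℝ) ≤ D := Nat.cast_nonneg D
  have hXr1 : (1 : ℝ) ≤ Xr := by rw [hXrX]; linarith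
  have hXr3 : (3 : ℝ) ≤ Xr := by rw [hXrX]; linarith
  have hXr0 : 0 < Xr := by linarith
  have hXr2 : Xr ≤ 2 * X₀ := by rw [hXrX]; linarith
  have hX₀Xr : (X₀ : ℝ) ≤ Xr := by rw [hXrX]; linarith
  have haXr : a ≤ Xr := by
    have h1 : (⌈a⌉₊ : ℝ) ≤ X₀ := by exact_mod_cast haX
    have h2 := Nat.le_ceil a
    rw [hXrX]; linarith
  have ha₂X₀ : a₂ ≤ X₀ := by
    have h1 : (⌈a₂⌉₊ : ℝ) ≤ X₀ := by exact_mod_cast ha₂X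
    have h2 := Nat.le_ceil a₂
    linarith
  have hlogX₀1 : 1 ≤ Real.log X₀ := by
    rw [Real.le_log_iff_exp_le hX₀0]
    have := Real.exp_one_lt_d9
    linarith
  -- the dyadic bound at `U₀ = K_U X₁^{d/2}`
  set U₀ : ℝ := KU * Xr ^ ((d : ℝ) / 2) with hU₀
  have hU₀X : Xr ≤ U₀ := by
    have h1 : Xr ≤ Xr ^ ((d : ℝ) / 2) := by
      have := Real.rpow_le_rpow_of_exponent_le hXr1 (show (1 : ℝ) ≤ (d : ℝ) / 2 by linarith)
      rwa [Real.rpow_one] at this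
    exact h1.trans (le_mul_of_one_le_left (by positivity) hKU1)
  have hU₀0 : 0 < U₀ := by positivity
  have hlogU0 : 0 ≤ Real.log U₀ := Real.log_nonneg (hXr1.trans hU₀X)
  set OLD : ℝ := (2 + Real.log U₀) * (Xr * U₀ ^ (1 - η₁) + Xr * D * Xr ^ (1 - η₁ - 2 / d))
      + U₀ ^ (2 - θ) + D * U₀ ^ (2 - θ - 2 / d) with hOLD
  set AP : ℝ := Xr * D + Xr * U₀ ^ (1 - σ) + Xr * D * Xr ^ (1 - σ - 2 / d) with hAP
  set GP : ℝ := Xr * D * Xr ^ (σ - η₁) with hGP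
  have hOLD0 : 0 ≤ OLD := by positivity
  have hAP0 : 0 ≤ AP := by positivity
  have hGP0 : 0 ≤ GP := by positivity
  set Bmax : ℝ := K * (ε * AP + GP + OLD) with hBmax
  have hBmax0 : 0 ≤ Bmax := by positivity
  have hΦ : ∀ E : ℕ, X₀ + D ≤ E → (E : ℝ) ≤ U₀ →
      K * (ε * ((X₀ + D : ℕ) * (D : ℝ) + (X₀ + D : ℕ) * (E : ℝ) ^ (1 - σ)
            + (X₀ + D : ℕ) * D * (E : ℝ) ^ (1 - σ - 2 / d))
          + (X₀ + D : ℕ) * D * (E : ℝ) ^ (σ - η₁)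
          + ((2 + Real.log E) * ((X₀ + D : ℕ) * (E : ℝ) ^ (1 - η₁)
              + (X₀ + D : ℕ) * D * (E : ℝ) ^ (1 - η₁ - 2 / d))
            + (E : ℝ) ^ (2 - θ) + D * (E : ℝ) ^ (2 - θ - 2 / d))) ≤ Bmax := by
    intro E hE hEU
    have hE0 : (0 : ℝ) < E := by exact_mod_cast (show 0 < E by omega)
    have hXE : Xr ≤ E := by rw [hXr]; exact_mod_cast hE
    have i1 : Real.log E ≤ Real.log U₀ := Real.log_le_log hE0 hEU
    have i2 : (E : ℝ) ^ (1 - η₁) ≤ U₀ ^ (1 - η₁) := Real.rpow_le_rpow hE0.le hEU (by linarith)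
    have i3 : (E : ℝ) ^ (1 - η₁ - 2 / d) ≤ Xr ^ (1 - η₁ - 2 / d) :=
      Real.rpow_le_rpow_of_nonpos hXr0 hXE (by linarith)
    have i4 : (E : ℝ) ^ (2 - θ) ≤ U₀ ^ (2 - θ) := Real.rpow_le_rpow hE0.le hEU (by linarith)
    have i5 : (E : ℝ) ^ (2 - θ - 2 / d) ≤ U₀ ^ (2 - θ - 2 / d) := Real.rpow_le_rpow hE0.le hEU (by linarith)
    have i6 : (E : ℝ) ^ (1 - σ) ≤ U₀ ^ (1 - σ) := Real.rpow_le_rpow hE0.le hEU (by linarith)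
    have i7 : (E : ℝ) ^ (1 - σ - 2 / d) ≤ Xr ^ (1 - σ - 2 / d) :=
      Real.rpow_le_rpow_of_nonpos hXr0 hXE (by linarith)
    have i8 : (E : ℝ) ^ (σ - η₁) ≤ Xr ^ (σ - η₁) := Real.rpow_le_rpow_of_nonpos hXr0 hXE (by linarith)
    have j1 : Xr * (E : ℝ) ^ (1 - η₁) + Xr * D * (E : ℝ) ^ (1 - η₁ - 2 / d)
        ≤ Xr * U₀ ^ (1 - η₁) + Xr * D * Xr ^ (1 - η₁ - 2 / d) :=
      add_le_add (mul_le_mul_of_nonneg_left i2 hXr0.le) (mul_le_mul_of_nonneg_left i3 (by positivity))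
    have j2 : (2 + Real.log E) * (Xr * (E : ℝ) ^ (1 - η₁) + Xr * D * (E : ℝ) ^ (1 - η₁ - 2 / d))
        ≤ (2 + Real.log U₀) * (Xr * U₀ ^ (1 - η₁) + Xr * D * Xr ^ (1 - η₁ - 2 / d)) :=
      mul_le_mul (by linarith) j1 (by positivity) (by linarith)
    have j3 : ε * (Xr * (D : ℝ) + Xr * (E : ℝ) ^ (1 - σ) + Xr * D * (E : ℝ) ^ (1 - σ - 2 / d)) ≤ ε * AP := by
      rw [hAP]
      apply mul_le_mul_of_nonneg_left _ hε0.le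
      exact add_le_add (add_le_add le_rfl (mul_le_mul_of_nonneg_left i6 hXr0.le))
        (mul_le_mul_of_nonneg_left i7 (by positivity))
    have j4 : Xr * D * (E : ℝ) ^ (σ - η₁) ≤ GP := mul_le_mul_of_nonneg_left i8 (by positivity)
    rw [hBmax]
    apply mul_le_mul_of_nonneg_left _ hK0
    have j5 := add_le_add (add_le_add j2 i4) (mul_le_mul_of_nonneg_left i5 hD0)
    rw [hOLD]
    linarith [j3, j4, j5]
  have hZ := norm_trapSum_le_dyadic_of_le g hΔ hz hB hBmax0
    (fun E E' hE hEE' hE'2 => hE₀ X₀ D E E' (by omega) hDX hE (by omega) hEE' hE'2) hΦ (by omega)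
    (show Real.exp Δ * Real.exp (B / 2) * Xr ^ ((d : ℝ) / 2) ≤ U₀ from le_rfl) hU₀X
  refine hZ.trans ?_
  clear hZ hΦ hE₀ hK
  -- the number of blocks
  have hJ1 := natLog_le_of_le_pow hKU1 hXr1 hdpos.le (Nat.floor_le hU₀0.le)
  set L₁ : ℝ := 1 + Real.log Xr with hL₁
  have hlogXr : 0 ≤ Real.log Xr := Real.log_nonneg hXr1
  have hL₁1 : 1 ≤ L₁ := by rw [hL₁]; linarith
  have hL₁3 : L₁ ≤ 3 * Real.log X₀ := one_add_log_le_three_mul_log hX₀r3 hXr0 hXr2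
  set Jr : ℝ := (Nat.log 2 ⌊U₀⌋₊ : ℝ) + 1 with hJr
  have hJr0 : 0 ≤ Jr := by positivity
  have hJr3 : Jr ≤ (2 * cL + 1) * (3 * Real.log X₀) :=
    hJ1.trans (mul_le_mul_of_nonneg_left hL₁3 (by positivity))
  -- (1) the old monomials
  have hB1 := trapBmax_le (D := (D : ℝ)) hK0 hKU1 hXr1 hD0 hdpos hη₁1 hθ1 hθ0 h2d1 hκ0.le
    hκle₁ hκle₂ hκle₃
  have hold : Jr * (K * OLD) ≤ ε₃ * D * (X₀ * Real.log X₀) := by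
    have hJB : Jr * (K * OLD) ≤ Kf * L₁ ^ 2 * (Xr ^ (2 - κ) + D * Xr ^ (1 - κ)) := by
      have h1 : cL * L₁ + 1 ≤ (cL + 1) * L₁ := by linarith
      have hKO : 0 ≤ K * OLD := by positivity
      calc Jr * (K * OLD)
          ≤ ((2 * cL + 1) * L₁) * (K * KU ^ (2 : ℝ) * (cL * L₁ + 1) * (Xr ^ (2 - κ) + D * Xr ^ (1 - κ))) :=
            mul_le_mul hJ1 hB1 hKO (by positivity)
        _ = K * KU ^ (2 : ℝ) * (2 * cL + 1) * L₁ * (Xr ^ (2 - κ) + D * Xr ^ (1 - κ)) * (cL * L₁ + 1) := by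
            ring
        _ ≤ K * KU ^ (2 : ℝ) * (2 * cL + 1) * L₁ * (Xr ^ (2 - κ) + D * Xr ^ (1 - κ)) * ((cL + 1) * L₁) :=
            mul_le_mul_of_nonneg_left h1 (by positivity)
        _ = Kf * L₁ ^ 2 * (Xr ^ (2 - κ) + D * Xr ^ (1 - κ)) := by rw [hKf]; ring
    refine hJB.trans ?_
    have hlo : L₁ ^ 2 ≤ c₁ * Xr ^ κ := by
      have h := ha Xr haXr
      rw [Real.rpow_two, Real.norm_of_nonneg (sq_nonneg _), Real.norm_of_nonneg (by positivity)] at h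
      exact one_add_log_sq_le hXr3 h
    exact trapFinal_le hKf0 hXr0 hδ hε₃0 hc₁0.le hX₀r3 hD0 hδD hXr2 hlo hc₁le
  -- (2) the `o(E)` monomials
  have hap : Jr * (K * (ε * AP)) ≤ ε₃ * D * (X₀ * Real.log X₀) := by
    have hU₁ : U₀ ^ (1 - σ) ≤ KU * Xr := by
      rw [hU₀, Real.mul_rpow hKU0.le (by positivity), ← Real.rpow_mul hXr0.le]
      have h1 : KU ^ (1 - σ) ≤ KU := by
        have := Real.rpow_le_rpow_of_exponent_le hKU1 (show 1 - σ ≤ 1 by linarith)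
        rwa [Real.rpow_one] at this
      have h2 : Xr ^ ((d : ℝ) / 2 * (1 - σ)) ≤ Xr := by
        have := Real.rpow_le_rpow_of_exponent_le hXr1 hdσ
        rwa [Real.rpow_one] at this
      exact mul_le_mul h1 h2 (by positivity) (by positivity)
    have hU₂ : Xr ^ (1 - σ - 2 / d) ≤ 1 := Real.rpow_le_one_of_one_le_of_nonpos hXr1 (by linarith)
    have hAP1 : AP ≤ KU * ((4 + 4 / δ) * (D * X₀)) := by
      have t1 : Xr * U₀ ^ (1 - σ) ≤ Xr * (KU * Xr) := mul_le_mul_of_nonneg_left hU₁ hXr0.le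
      have t2 : Xr * D * Xr ^ (1 - σ - 2 / d) ≤ Xr * D := by
        have := mul_le_mul_of_nonneg_left hU₂ (by positivity : 0 ≤ Xr * D); linarith
      have t3 : Xr * Xr ≤ 4 / δ * (D * X₀) := by
        have hX₀D : (X₀ : ℝ) ≤ D / δ := by rw [le_div_iff₀ hδ]; linarith
        calc Xr * Xr ≤ (2 * X₀) * (2 * X₀) := mul_le_mul hXr2 hXr2 hXr0.le (by positivity)
          _ = 4 * (X₀ * X₀) := by ring
          _ ≤ 4 * (D / δ * X₀) := by
              apply mul_le_mul_of_nonneg_left _ (by norm_num)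
              exact mul_le_mul_of_nonneg_right hX₀D hX₀0.le
          _ = 4 / δ * (D * X₀) := by ring
      have t4 : Xr * D ≤ 2 * (D * X₀) := by
        have := mul_le_mul_of_nonneg_right hXr2 hD0; linarith
      have t5 : 2 * (Xr * D) ≤ KU * (4 * (D * X₀)) := by
        have := mul_le_mul hKU1 (by linarith : 2 * (Xr * D) ≤ 4 * (D * X₀)) (by positivity) hKU0.le
        linarith
      calc AP = Xr * D + Xr * U₀ ^ (1 - σ) + Xr * D * Xr ^ (1 - σ - 2 / d) := by rw [hAP]
        _ ≤ 2 * (Xr * D) + KU * (Xr * Xr) := by linarith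
        _ ≤ KU * (4 * (D * X₀)) + KU * (4 / δ * (D * X₀)) := by
            have := mul_le_mul_of_nonneg_left t3 hKU0.le; linarith
        _ = KU * ((4 + 4 / δ) * (D * X₀)) := by ring
    calc Jr * (K * (ε * AP)) ≤ ((2 * cL + 1) * (3 * Real.log X₀)) * (K * (ε * (KU * ((4 + 4 / δ) * (D * X₀))))) := by
          apply mul_le_mul hJr3 _ (by positivity) (by positivity)
          exact mul_le_mul_of_nonneg_left (mul_le_mul_of_nonneg_left hAP1 hε0.le) hK0
      _ = (Q₁ * ε) * D * (X₀ * Real.log X₀) := by rw [hQ₁]; ring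
      _ ≤ ε₃ * D * (X₀ * Real.log X₀) := by
          apply mul_le_mul_of_nonneg_right (mul_le_mul_of_nonneg_right hεle hD0) (by positivity)
  -- (3) the new monomial
  have hgp : Jr * (K * GP) ≤ ε₃ * D * (X₀ * Real.log X₀) := by
    have hpow : Xr ^ (σ - η₁) ≤ c₂ := by
      have h1 : Xr ^ (σ - η₁) ≤ (X₀ : ℝ) ^ (σ - η₁) := Real.rpow_le_rpow_of_nonpos hX₀0 hX₀Xr (by linarith)
      have h2 : (X₀ : ℝ) ^ (-(η₁ - σ)) ≤ c₂ := ha₂ X₀ ha₂X₀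
      rw [show -(η₁ - σ) = σ - η₁ by ring] at h2
      exact h1.trans h2
    have hGP1 : GP ≤ 2 * (D * X₀) * c₂ := by
      rw [hGP]
      have t1 : Xr * D ≤ 2 * (D * X₀) := by
        have := mul_le_mul_of_nonneg_right hXr2 hD0; linarith
      exact mul_le_mul t1 hpow (by positivity) (by positivity)
    calc Jr * (K * GP) ≤ ((2 * cL + 1) * (3 * Real.log X₀)) * (K * (2 * (D * X₀) * c₂)) := by
          apply mul_le_mul hJr3 (mul_le_mul_of_nonneg_left hGP1 hK0) (by positivity) (by positivity)
      _ = (Q₂ * c₂) * D * (X₀ * Real.log X₀) := by rw [hQ₂]; ring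
      _ ≤ ε₃ * D * (X₀ * Real.log X₀) := by
          apply mul_le_mul_of_nonneg_right (mul_le_mul_of_nonneg_right hc₂le hD0) (by positivity)
  have hsplit : Jr * Bmax = Jr * (K * (ε * AP)) + Jr * (K * GP) + Jr * (K * OLD) := by rw [hBmax]; ring
  rw [hsplit]
  have : ε' * D * (X₀ * Real.log X₀) = 3 * (ε₃ * D * (X₀ * Real.log X₀)) := by rw [hε₃]; ring
  rw [this]
  linarith [hold, hap, hgp]

/-- **ERDŐS'S ASYMPTOTICS FROM THE SCALE PROFILE.**  For `g` irreducible of degree `d ≥ 3`, `2 − 4/d < θ ≤ 1`,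
`1 − 2/d < η`:  `HooleyMeanProfile g θ η → ErdosDivisorSumAsymptotic g`.  The hypothesis: for every `ε > 0` and
`E ≥ E₀(ε)`, `E ≤ E' ≤ 2E`, `H ≤ E^θ`,
`∑_{1≤h≤H} (|∑_{E<e≤E'} S_g(h;e)| + |∑_{E<e≤E'} S_g(−h;e)|) ≤ εE + C·H·E^{1−η}` —
equidistribution of the roots of `g (mod e)` on average over dyadic blocks with NO rate at bounded frequencies,
and a power saving only relative to the length of the frequency average.  [this work] -/
theorem erdosDivisorSumAsymptotic_of_hooleyMeanProfile {g : ℤ[X]} (hirr : Irreducible g)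
    (hdeg : 3 ≤ g.natDegree) {θ η : ℝ} (hθ : 2 - 4 / (g.natDegree : ℝ) < θ) (hθ1 : θ ≤ 1)
    (hη : 1 - 2 / (g.natDegree : ℝ) < η) (hmp : HooleyMeanProfile g θ η) : ErdosDivisorSumAsymptotic g :=
  erdosDivisorSumAsymptotic_of_trapezoidCancellation hirr hdeg one_pos
    (trapezoidCancellation_of_hooleyMeanProfile hirr hdeg one_pos hθ hθ1 hη hmp)

/-- The cubic case: for an irreducible cubic `g`, `θ ∈ (2/3, 1]` and `η > 1/3`,
`HooleyMeanProfile g θ η → ErdosDivisorSumAsymptotic g`. [this work] -/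
theorem erdosDivisorSumAsymptotic_cubic_of_hooleyMeanProfile {g : ℤ[X]} (hirr : Irreducible g)
    (hdeg : g.natDegree = 3) {θ η : ℝ} (hθ : 2 / 3 < θ) (hθ1 : θ ≤ 1) (hη : 1 / 3 < η)
    (hmp : HooleyMeanProfile g θ η) : ErdosDivisorSumAsymptotic g :=
  erdosDivisorSumAsymptotic_of_hooleyMeanProfile hirr hdeg.ge (by rw [hdeg]; push_cast; linarith) hθ1
    (by rw [hdeg]; push_cast; linarith) hmp

end Summit.Parity.BatemanHorn.Theorems
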